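import Literature.AlgebraicGeometry.HodgeTheory.HypersurfaceResidueFormSymmetry
import Literature.AlgebraicGeometry.HodgeTheory.CalabiYauHypersurfaceTopFormCharacter
import Literature.AlgebraicGeometry.HodgeTheory.DiagonalSymmetryEigenHodgeNumbers
import Literature.AlgebraicGeometry.Motives.NonsingularFormIrreducible
import HarnessLib

/-!
# Griffiths' residues at pole order one, PROVED: the equivariant injection
# `S^{d−n−2} ↪ H^{n,0}(X_F)`, `P ↦ [Res(PΩ/F)]`, for every smooth hypersurface

Family `hodge`, layer `Literature/AlgebraicGeometry/HodgeTheory`. PROOF FILE (theorems only; no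
definition, no named fact — D-0026). The tree vendors Griffiths' description of the Hodge filtration
of a smooth hypersurface `X_F = V₊(F) ⊂ ℙⁿ⁺¹` by residues of rational forms as NAMED FACTS
(`Griffiths1969_residues_span_hodgeFiltration`, `Griffiths1969_residueKernel_eq_jacobianIdeal`,
`Griffiths1969_residues_primitive`: for every pole order `l` a residue map `res_l : S^{ld−n−2} → Hⁿ`
with (i) image in `F^{n+1−l}`, (ii) spanning it modulo `ι^*Hⁿ(ℙⁿ⁺¹)`, (iii) naturality under the
diagonal stabiliser with the `det` twist, (iv) kernel = Jacobian ideal). This file PROVES the slice of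
that package at pole order `l = 1` which the tree's analysis reaches — clauses (i), (iii) and the
injectivity half of (iv) (the Jacobian ideal has no elements of degree `d − n − 2 < d − 1`):

* `exists_residueMap_poleOrderOne` — for a nonsingular form `F` of degree `d ≥ n + 2` in `n + 2 ≥ 3`
  variables with `X_F` smooth projective of dimension `n`, and ANY Hodge model `A` of `X_F`, there is a
  `ℂ`-linear map `res₁ : ℂ[x₀,…,x_{n+1}] → Hⁿ(X_F(ℂ); ℂ)` with
  (i)   `A^*(res₁ P) ∈ H^{n,0}_A` for every `P`;
  (iii) `g_a^* res₁(P) = (∏ᵢ aᵢ) · res₁(P(a • x))` for `a ∈ diagonalStabilizer F` and `P` homogeneous of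
        degree `d − n − 2`;
  (inj) `res₁ P = 0 → P = 0` for `P` homogeneous of degree `d − n − 2`.
  Construction: `res₁ P` is the class of the holomorphic `n`-form `Res(P_{d−n−2} Ω/F)` on `X^an`
  (`residueForm`, `isHolomorphicInCharts_residueForm` — the tree's Poincaré-residue programme of
  `HypersurfaceResidueForm*`, with the numerator projected to its degree-`(d−n−2)` component to make the
  map total), carried to `Hⁿ(X(ℂ); ℂ)` by the class map `Ω^n(X^an) → H^{n,0}` (Voisin I Cor. 7.6,
  `HodgeModel.topHolFormClass`) and the comparison `A^*`. (i) is `topHolFormClass_mem_hodgePQ`; (iii) is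
  the form identity `(g_a^an)^* Res(PΩ/F) = det(a) · Res(P(a • x)Ω/F)` (`pullback_residueForm_symm`)
  pushed through the naturality of the de Rham comparison; (inj) is `topHolFormClass_injective` (a
  non-zero holomorphic top form is not exact) with `eq_zero_of_residueForm_eq_zero` (a form `P` of
  degree `< d` vanishing on the cone of the prime `F` is `0`; nonsingular forms in `≥ 3` variables are
  prime, `IsNonsingularForm.prime`).
* `finrank_twistedEigenspace_le_finrank_eigenspace_inf_hodgePQ` — consequence for a single diagonal
  symmetry `σ_a`: for every `μ`, `dim_ℂ (S^{d−n−2})_μ ≤ dim_ℂ (E_μ(σ_a^*) ∩ H^{n,0}(X_F))`, the left side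
  being the `μ`-eigenspace of the twisted action `T_a P = (∏ aᵢ) P(a • x)` (`twistedDiagonalAction`) on
  forms of degree `d − n − 2` and the right side read in any Hodge model.

In print: Voisin II §6.1.3, Cor. 6.12 at `p = 1` ("the residue map induces a natural isomorphism
`R_f^{d−n−1} ≅ H^{n−1,0}(Y)`", her `n = dim ℙ`; `R_F^{d−n−2} = S^{d−n−2}`), with the naturality
`g^* Res(PΩ/F) = det(g) Res((P∘g)Ω/F)` of Shioda 1979 §1 (1.7) / Voisin II §6.1.3. The SURJECTIVITY
half (`h^{n,0}(X_F) ≤ dim S^{d−n−2}`: every holomorphic `n`-form is a residue; adjunction + Serre GAGA)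
is NOT proved here.

## References

* [VoisinHodgeII2003] C. Voisin, Hodge Theory and Complex Algebraic Geometry II (2003), §6.1.3
  Thm. 6.10, Cor. 6.12.
* [VoisinHodgeI2002] C. Voisin, Hodge Theory and Complex Algebraic Geometry I (2002), §7.1.1
  Prop. 7.5, Cor. 7.6, §7.3.2.
* [Shioda1979HodgeFermat] T. Shioda, The Hodge conjecture for Fermat varieties, Math. Ann. 245
  (1979), §1 (1.7).
* [Griffiths1969] P. Griffiths, On the periods of certain rational integrals I, Ann. of Math. 90
  (1969), §8.
* [SerreGAGA1956] J.-P. Serre, GAGA, Ann. Inst. Fourier 6 (1956), §2 n°5.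
-/

noncomputable section

open scoped Manifold ContDiff Topology LinearAlgebra.Projectivization TensorProduct
open CategoryTheory AlgebraicGeometry

namespace Literature.AlgebraicGeometry.HodgeTheory

open Literature.AlgebraicGeometry.Motives Literature.AlgebraicTopology.SingularHomology
  Literature.NumberTheory.Transcendental Literature.Geometry.Kaehler

variable {n : ℕ} {F : MvPolynomial (Fin (n + 2)) ℂ}

/-- **The concrete holomorphic model of a Hodge model of a hypersurface** (the passage used by
`hypersurface_eigenform_top_eq_zero_of_ne_prod`): `ψ = pt ∘ A.toComplexPoints` is a topological
embedding of `A.carrier` onto `V(F) ⊂ ℙ(ℂⁿ⁺²)` with holomorphic affine coordinates, and the Jacobian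
condition holds on the cone of the nonsingular `F`. [cite: SerreGAGA1956, §2 n°5] -/
theorem hypersurface_hodgeModel_coords {d : ℕ} (hF : F.IsHomogeneous d)
    (hJ : SmoothHypersurface.IsNonsingularForm ℂ F)
    (A : HodgeModel n (SmoothHypersurface.hypersurface F)) :
    Topology.IsEmbedding (hypersurfacePoint (SmoothHypersurface.hypersurfaceι F) ∘ A.toComplexPoints) ∧
      Set.range (hypersurfacePoint (SmoothHypersurface.hypersurfaceι F) ∘ A.toComplexPoints) =
        Projectivization.projZeroLocus {F} ∧
      HasHolomorphicCoords A.model (hypersurfacePoint (SmoothHypersurface.hypersurfaceι F) ∘ A.toComplexPoints) ∧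
      (∀ z : Fin (n + 2) → ℂ, z ≠ 0 → MvPolynomial.eval z F = 0 →
        ∃ j, MvPolynomial.eval z (MvPolynomial.pderiv j F) ≠ 0) := by
  obtain ⟨hemb, hrangeψ, hcoord⟩ := hypersurface_complexPoints
    (SmoothHypersurface.hypersurfaceι F) hF (SmoothHypersurface.range_hypersurfaceι F)
  set ψ : A.carrier → ℙ ℂ (Fin (n + 2) → ℂ) :=
    hypersurfacePoint (SmoothHypersurface.hypersurfaceι F) ∘ A.toComplexPoints with hψ
  refine ⟨hemb.comp A.isAnalytification.homeomorph.isEmbedding, ?_, ?_, fun z hz hFz ↦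
    hJ.exists_eval_pderiv_ne_zero hz hFz⟩
  · rw [Set.range_comp, A.isAnalytification.isHomeomorph.surjective.range_eq, Set.image_univ, hrangeψ]
  · intro i j
    obtain ⟨U, hU, hsU⟩ := hcoord i
    obtain ⟨s, hs'⟩ := hsU j
    have hhol := A.isAnalytification.mdifferentiableOn_evalOrZero U s
    have hset : ψ ⁻¹' (Projectivization.stdChart i).source =
        A.toComplexPoints ⁻¹' {P | P.pt ∈ (↑U : (SmoothHypersurface.hypersurface F).left.Opens)} := by
      rw [hU, hψ, Set.preimage_comp]
    change MDifferentiableOn 𝓘(ℂ, A.model) 𝓘(ℂ, ℂ) _ (ψ ⁻¹' (Projectivization.stdChart i).source)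
    rw [hset]
    exact hhol.congr fun x hx ↦ (hs' (A.toComplexPoints x) hx).symm

/-- **Griffiths' residues at pole order one** (Voisin II §6.1.3, Cor. 6.12 at `p = 1`, PROVED in the
tree's carriers; clauses (i), (iii) and the injectivity half of (iv) of the vendored residue package at
`l = 1`). For a nonsingular form `F` of degree `d ≥ n + 2` in `n + 2 ≥ 3` variables with
`X_F = V₊(F)` smooth projective of dimension `n`, and any Hodge model `A` of `X_F`, there is a
`ℂ`-linear `res₁ : ℂ[x₀, …, x_{n+1}] → Hⁿ(X_F(ℂ); ℂ)` — `P ↦` the class of the holomorphic `n`-form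
`ψ^* Res_Y(P_{d−n−2} Ω/F)` on `X^an` (`P_{d−n−2}` the degree-`(d−n−2)` component of `P`) — with:
(i) `A^*(res₁ P) ∈ H^{n,0}_A`; (iii) `g_a^* res₁(P) = (∏ᵢ aᵢ) · res₁(P(a • x))` for every `a` in the
diagonal stabiliser of `F` and `P` homogeneous of degree `d − n − 2` (`g_a = diagonalMap F ha`,
`P(a • x) = aeval (diagonalSubst a) P`); (inj) `res₁ P = 0 → P = 0` for such `P`. In print: "the
residue map induces a natural isomorphism `R_f^{pd−n−1} ≅ H^{n−p,p−1}(Y)_prim`" at `p = 1`, where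
`R_F^{d−n−2} = S^{d−n−2}`, and the residue is equivariant with `g^*Ω = det(g) Ω`.
[cite: VoisinHodgeII2003, §6.1.3 Thm. 6.10 and Cor. 6.12 (p = 1)]
[cite: VoisinHodgeI2002, §7.1.1 Cor. 7.6] [cite: Shioda1979HodgeFermat, §1 (1.7)] -/
theorem exists_residueMap_poleOrderOne (hn : 1 ≤ n) {d : ℕ} (hd : n + 2 ≤ d)
    (hF : F.IsHomogeneous d) (hJ : SmoothHypersurface.IsNonsingularForm ℂ F)
    (hX : IsSmoothProjective n (SmoothHypersurface.hypersurface F))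
    (A : HodgeModel n (SmoothHypersurface.hypersurface F)) :
    ∃ res : MvPolynomial (Fin (n + 2)) ℂ →ₗ[ℂ] complexBetti (SmoothHypersurface.hypersurface F) n,
      (∀ P, A.pullback n (res P) ∈ A.hodgePQ n n 0) ∧
      (∀ (a : Fin (n + 2) → ℂˣ) (ha : a ∈ diagonalStabilizer F) (P : MvPolynomial (Fin (n + 2)) ℂ),
          P.IsHomogeneous (d - (n + 2)) →
          singularCohomology.map ℂ ℂ (diagonalMap F ha) n (res P) =
            (∏ i, ((a i : ℂˣ) : ℂ)) • res (MvPolynomial.aeval (diagonalSubst a) P)) ∧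
      (∀ P : MvPolynomial (Fin (n + 2)) ℂ, P.IsHomogeneous (d - (n + 2)) → res P = 0 → P = 0) := by
  classical
  obtain ⟨hψemb, hψrange, hhol, hjac⟩ := hypersurface_hodgeModel_coords hF hJ A
  set ψ : A.carrier → ℙ ℂ (Fin (n + 2) → ℂ) :=
    hypersurfacePoint (SmoothHypersurface.hypersurfaceι F) ∘ A.toComplexPoints with hψ
  haveI : CompactSpace A.carrier := A.compactSpace_carrier hX
  haveI : Nonempty A.carrier := A.nonempty_carrier hX
  set k := d - (n + 2) with hk
  have hhom : ∀ P : MvPolynomial (Fin (n + 2)) ℂ,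
      (MvPolynomial.homogeneousComponent k P).IsHomogeneous (d - (n + 2)) := fun P ↦
    MvPolynomial.homogeneousComponent_isHomogeneous k P
  -- the residue FORM of the degree-`k` component, a holomorphic `n`-form, linear in `P`
  let L : MvPolynomial (Fin (n + 2)) ℂ →ₗ[ℂ] holFormsInCharts A.model A.carrier n :=
    { toFun := fun P ↦ ⟨residueForm (E := A.model) ψ F (MvPolynomial.homogeneousComponent k P),
        isHolomorphicInCharts_residueForm ψ hF hψemb.continuous hψrange.le hjac hhol (hhom P) hd⟩
      map_add' := fun P Q ↦ by
        apply Subtype.ext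
        change residueForm (E := A.model) ψ F (MvPolynomial.homogeneousComponent k (P + Q)) =
          residueForm ψ F (MvPolynomial.homogeneousComponent k P) +
            residueForm ψ F (MvPolynomial.homogeneousComponent k Q)
        rw [map_add, residueForm_add]
      map_smul' := fun c P ↦ by
        apply Subtype.ext
        change residueForm (E := A.model) ψ F (MvPolynomial.homogeneousComponent k (c • P)) =
          c • residueForm ψ F (MvPolynomial.homogeneousComponent k P)
        rw [map_smul, residueForm_smul] }
  have hL : ∀ P, (L P : MForm 𝓘(ℝ, A.model) A.carrier ℂ n) =
      residueForm (E := A.model) ψ F (MvPolynomial.homogeneousComponent k P) := fun P ↦ rfl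
  -- its class, carried to `Hⁿ(X(ℂ); ℂ)`
  let res : MvPolynomial (Fin (n + 2)) ℂ →ₗ[ℂ] complexBetti (SmoothHypersurface.hypersurface F) n :=
    (A.pullbackEquiv n).symm.toLinearMap ∘ₗ A.topHolFormClass ∘ₗ L
  have hres : ∀ P, A.pullback n (res P) = A.topHolFormClass (L P) := fun P ↦ by
    change A.pullbackEquiv n ((A.pullbackEquiv n).symm (A.topHolFormClass (L P))) = _
    exact LinearEquiv.apply_symm_apply _ _
  refine ⟨res, fun P ↦ ?_, fun a ha P hP ↦ ?_, fun P hP h0 ↦ ?_⟩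
  · -- (i) type `(n, 0)`
    rw [hres]
    exact A.topHolFormClass_mem_hodgePQ _
  · -- (iii) equivariance under the diagonal stabiliser
    set Q := MvPolynomial.aeval (diagonalSubst a) P with hQ
    have hPk : MvPolynomial.homogeneousComponent k P = P := MvPolynomial.homogeneousComponent_eq_self hP
    have hQhom : Q.IsHomogeneous (d - (n + 2)) :=
      (MvPolynomial.mem_homogeneousSubmodule _ _).mp
        (aeval_diagonalSubst_mem a ((MvPolynomial.mem_homogeneousSubmodule _ _).mpr hP))
    have hQk : MvPolynomial.homogeneousComponent k Q = Q := MvPolynomial.homogeneousComponent_eq_self hQhom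
    set Φ : A.carrier → A.carrier := HodgeModel.anMap A A (diagonalAut F ha) with hΦ
    have hΦd : MDifferentiable 𝓘(ℂ, A.model) 𝓘(ℂ, A.model) Φ :=
      HodgeModel.mdifferentiable_anMap A A _ hX hX
    have hΦs : ContMDiff 𝓘(ℝ, A.model) 𝓘(ℝ, A.model) ∞ Φ := HodgeModel.contMDiff_anMap A A _ hX hX
    have hΦψ : ∀ x : A.carrier, ψ (Φ x) =
        Projectivization.mk ℂ (a • (ψ x).rep)
          ((smul_ne_zero_iff_ne a).mpr (Projectivization.rep_nonzero _)) := by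
      intro x
      simp only [hψ, hΦ, Function.comp_apply, HodgeModel.toComplexPoints_anMap]
      rw [← diagonalMap_apply]
      exact hypersurfacePoint_diagonalMap F _ _
    have hFa : ∀ z, MvPolynomial.eval (a • z) F = MvPolynomial.eval z F :=
      eval_smul_of_mem_diagonalStabilizer ha
    -- the form identity `Φ^* Res(PΩ/F) = (∏ aᵢ) • Res(QΩ/F)`
    have hform : (L P : MForm 𝓘(ℝ, A.model) A.carrier ℂ n).pullback 𝓘(ℝ, A.model) Φ =
        (∏ i, ((a i : ℂˣ) : ℂ)) • (L Q : MForm 𝓘(ℝ, A.model) A.carrier ℂ n) := by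
      rw [hL, hL, hPk, hQk]
      exact pullback_residueForm_symm hΦψ hF hd hψemb.continuous hψrange.le hjac hhol hΦd hFa hP
        (fun z ↦ eval_aeval_diagonalSubst a z P)
    -- push it through the class map and the comparison
    apply A.pullback_injective n
    have hmap : A.pullback n (singularCohomology.map ℂ ℂ (diagonalMap F ha) n (res P)) =
        singularCohomology.map ℂ ℂ ⟨Φ, HodgeModel.continuous_anMap A A (diagonalAut F ha)⟩ n
          (A.pullback n (res P)) :=
      (HodgeModel.map_anMap_pullback A A (diagonalAut F ha) n (res P)).symm
    rw [hmap, map_smul, hres, hres, HodgeModel.topHolFormClass_apply, HodgeModel.topHolFormClass_apply]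
    have hnat := A.deRham_isNatural A.carrier A.carrier Φ hΦs n
      (complexDeRhamCohomology.mk A.model A.carrier n (holFormsInChartsToClosed A.finrank_model (L P)))
    have hcont : (⟨Φ, hΦs.continuous⟩ : C(A.carrier, A.carrier)) =
        ⟨Φ, HodgeModel.continuous_anMap A A (diagonalAut F ha)⟩ := rfl
    rw [hcont] at hnat
    rw [← hnat, complexDeRhamCohomology.map_mk, ← map_smul, ← map_smul]
    congr 2
    apply Subtype.ext
    simp only [Submodule.coe_smul, coe_holFormsInChartsToClosed]
    exact hform
  · -- (inj)
    have hPk : MvPolynomial.homogeneousComponent k P = P := MvPolynomial.homogeneousComponent_eq_self hP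
    have h1 : A.topHolFormClass (L P) = 0 := by rw [← hres, h0, map_zero]
    have h2 : L P = 0 := A.topHolFormClass_injective hX (by rw [h1, map_zero])
    have h3 : residueForm (E := A.model) ψ F P = 0 := by
      have h := congrArg (fun η : holFormsInCharts A.model A.carrier n ↦
        (η : MForm 𝓘(ℝ, A.model) A.carrier ℂ n)) h2
      simp only [hL, hPk, Submodule.coe_zero] at h
      exact h
    exact eq_zero_of_residueForm_eq_zero hF (hJ.prime hn (by omega) hF) hd hψemb hψrange hjac hhol
      A.finrank_model hP h3

/-- **Lower bound for the eigen-geometric-genus of a diagonal symmetry** (consequence of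
`exists_residueMap_poleOrderOne`; Shioda 1979 §1 (1.7) / Voisin II Cor. 6.12 at `p = 1`, read
equivariantly): for a nonsingular form `F` of degree `d ≥ n + 2` in `n + 2 ≥ 3` variables with `X_F`
smooth projective of dimension `n`, `a ∈ diagonalStabilizer F`, `σ_a = diagonalAut F ha` and any `μ`,
`dim_ℂ (S^{d−n−2})_μ ≤ dim_ℂ (E_μ(σ_a^* ⊗ ℂ) ∩ H^{n,0}(X_F))`, where `(S^{d−n−2})_μ` is the
`μ`-eigenspace of the twisted action `T_a P = (∏ aᵢ) P(a • x)` on forms of degree `d − n − 2`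
(spanned by the monomials `x^e` with `∏ aᵢ^{eᵢ+1} = μ`, `mem_eigenspace_twistedDiagonalAction_iff`)
and `H^{n,0}` is the piece of the tree's Hodge structure `BettiUniverse.hodge hHD hX n` on
`Hⁿ(X_F(ℂ); ℚ)`: the map `β⁻¹ ∘ res₁` sends `(S^{d−n−2})_μ` injectively into `E_μ ∩ H^{n,0}`.
Equality holds as soon as `h^{n,0}(X_F) ≤ dim S^{d−n−2}` (surjectivity of the residues, not proved
in the tree). [cite: VoisinHodgeII2003, §6.1.3 Cor. 6.12 (p = 1)] [cite: Shioda1979HodgeFermat, §1 (1.7)] -/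
theorem finrank_twistedEigenspace_le_finrank_eigenspace_inf_piece (hHD : exists_isReal_hodgeModel)
    (hn : 1 ≤ n) {d : ℕ} (hd : n + 2 ≤ d) (hF : F.IsHomogeneous d)
    (hJ : SmoothHypersurface.IsNonsingularForm ℂ F)
    (hX : IsSmoothProjective n (SmoothHypersurface.hypersurface F))
    {a : Fin (n + 2) → ℂˣ} (ha : a ∈ diagonalStabilizer F) (μ : ℂ) :
    Module.finrank ℂ ↥(Module.End.eigenspace (twistedDiagonalAction a) μ ⊓
        MvPolynomial.homogeneousSubmodule (Fin (n + 2)) ℂ (d - (n + 2))) ≤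
      Module.finrank ℂ ↥(Module.End.eigenspace ((BettiUniverse.pull (diagonalAut F ha) n).baseChange ℂ) μ ⊓
        (BettiUniverse.hodge hHD hX n).piece (n : ℤ) 0) := by
  classical
  set X := SmoothHypersurface.hypersurface F with hXdef
  set A := BettiUniverse.realHodgeModel hHD hX with hAdef
  set H := BettiUniverse.hodge hHD hX n with hHdef
  set gC := (BettiUniverse.pull (diagonalAut F ha) n).baseChange ℂ with hgC
  set T := twistedDiagonalAction a with hTdef
  set Sk := MvPolynomial.homogeneousSubmodule (Fin (n + 2)) ℂ (d - (n + 2)) with hSk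
  obtain ⟨res, h1, h3, h4⟩ := exists_residueMap_poleOrderOne hn hd hF hJ hX A
  set β := ofRatClassBaseChangeEquiv hX n with hβ
  set ρ : MvPolynomial (Fin (n + 2)) ℂ →ₗ[ℂ] ℂ ⊗[ℚ] ↥(bettiCohomology X n) :=
    β.symm.toLinearMap ∘ₗ res with hρ
  haveI : Module.Finite ℚ ↥(bettiCohomology X n) := BettiUniverse.finite hX n
  haveI : Module.Finite ℂ ↥Sk :=
    Module.Finite.iff_fg.mpr (MvPolynomial.homogeneousSubmodule_fg (Fin (n + 2)) ℂ (d - (n + 2)))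
  have hβρ : ∀ P, β (ρ P) = res P := fun P ↦ by
    rw [hρ, LinearMap.comp_apply, LinearEquiv.coe_toLinearMap, LinearEquiv.apply_symm_apply]
  -- `ρ P ∈ H^{n,0}`
  have hpiece : ∀ P, ρ P ∈ H.piece (n : ℤ) 0 := by
    intro P
    have hp : H.piece (n : ℤ) 0 = A.ratPiece hX n n 0 := by
      have h := A.piece_eq_ratPiece hX (BettiUniverse.realHodgeModel_isHodgeSymmetric hHD hX)
        (show n + 0 = n from rfl)
      rw [Nat.cast_zero] at h
      exact h
    rw [hp, HodgeModel.mem_ratPiece_iff, HodgeModel.complexification_apply]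
    change A.pullback n (β (ρ P)) ∈ A.hodgePQ n n 0
    rw [hβρ]
    exact h1 P
  -- equivariance `gC (ρ P) = ρ (T P)` on `S^k`
  have hβg : ∀ y, β (gC y) = complexBetti.map (diagonalAut F ha) n (β y) := fun y ↦
    HodgeModel.ofRatClassBaseChange_baseChange_map (diagonalAut F ha) n y
  have hequiv : ∀ P ∈ Sk, gC (ρ P) = ρ (T P) := by
    intro P hP
    apply β.injective
    rw [hβg, hβρ, hβρ, hTdef, twistedDiagonalAction_apply, map_smul]
    exact h3 a ha P ((MvPolynomial.mem_homogeneousSubmodule _ P).mp hP)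
  -- the eigen-subspace of forms maps into `E_μ ∩ H^{n,0}`, injectively
  set Sμ := Module.End.eigenspace T μ ⊓ Sk with hSμ
  haveI : FiniteDimensional ℂ ↥Sμ := Submodule.finiteDimensional_inf_right _ _
  have hmaple : Sμ.map ρ ≤ Module.End.eigenspace gC μ ⊓ H.piece (n : ℤ) 0 := by
    rintro _ ⟨P, ⟨hPμ, hP⟩, rfl⟩
    refine ⟨?_, hpiece P⟩
    rw [SetLike.mem_coe, Module.End.mem_eigenspace_iff, hequiv P hP,
      Module.End.mem_eigenspace_iff.mp hPμ, map_smul]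
  have hker : Sμ ⊓ LinearMap.ker ρ = ⊥ := by
    refine eq_bot_iff.mpr ?_
    rintro P ⟨⟨-, hP⟩, hPker⟩
    rw [Submodule.mem_bot]
    refine h4 P ((MvPolynomial.mem_homogeneousSubmodule _ P).mp hP) ?_
    have h0 : ρ P = 0 := LinearMap.mem_ker.mp hPker
    rw [← hβρ, h0, map_zero]
  have hrank := finrank_map_add_finrank_inf_ker ρ Sμ
  rw [hker, finrank_bot, add_zero] at hrank
  rw [← hrank]
  exact Submodule.finrank_mono hmaple

end Literature.AlgebraicGeometry.HodgeTheory

end
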